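import Literature.Analysis.Complex.CahenMellinSector
import HarnessLib

/-!
# The Conrey–Ghosh transform (Booker 2003, Lemma 2), I: kernels and the termwise identity

Topic `Literature/NumberTheory/LFunctions`. Everything here is PROVED; no named facts, no
definitions. Source: A. R. Booker, *Poles of Artin L-functions and the strong Artin conjecture*,
Ann. of Math. 158 (2003), Lemma 2 (pp. 1093–1094) — "the main device in the proof is a technique
developed by Conrey and Ghosh [7] … [it] transforms the two parts of (3) into integrals of
additive twists of `L(s, ρ)` against (essentially) `δ^{-s}`" (p. 1091). Lemma 2 reads: for
`α > 0` rational, `ν = ±1`, `0 < δ < π/2`,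

  `(1/2πi) ∫ L(s, ρ) (α e^{iν(π/2-δ)})^{1/2-s} (2π)^{-s} Γ(s + c) ds`
  `= (1/2πi) ∫ L(s, ρ, να) α^{1/2-s} e^{iν[(δ/2)(s-c-1) + (π/2)(c+1/2)]} (2 sin(δ/2))^{-(s+c)} (2π)^{-s} Γ(s+c) ds`   (9)

(integrals on a vertical line far to the right; `L(s, ρ, α) = ∑ aₙ e(-nα) n^{-s}` the additive
twist (4)). The printed proof: with `F(z) = z^c e^{-z} = (1/2πi) ∫ Γ(s + c) z^{-s} ds` (10),
substitute `L(s, ρ) = ∑ aₙ n^{-s}` and compute termwise (11).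

This file does the termwise computation for ONE term `n^{-s}`, for an arbitrary coefficient:
* `lhs_factor`, `rhs_factor` — the two integrands of (9) against `n^{-s}` are constant multiples
  of `Γ(s + c) z^{-s}` with `z = zₙ = 2παn e^{iν(π/2-δ)}`, resp. `z = wₙ = 2παn·2 sin(δ/2)·e^{-iνδ/2}`
  (principal powers throughout, written out through `exp`/`log`: `ofReal_mul_exp_cpow` etc.);
* `integral_lhs_kernel`, `integral_rhs_kernel` — hence, by (10) for complex argument
  (`Literature.Analysis.Complex.integral_Gamma_add_mul_cpow_neg_eq`, `re zₙ, re wₙ > 0`), the two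
  termwise integrals are `(α e^{iθ})^{1/2} · 2π zₙ^c e^{-zₙ}` and
  `α^{1/2} e^{iν[(δ/2)(-c-1)+(π/2)(c+1/2)]} (2 sin(δ/2))^{-c} · 2π wₙ^c e^{-wₙ}`;
* `exp_nu_mul_eq` — the trigonometric identity `e^{iν(π/2-δ)} = iν + 2 sin(δ/2) e^{-iνδ/2}`
  (`ν = ±1`), i.e. `zₙ = 2πiναn + wₙ`, whence `e^{-zₙ} = e(-ναn) e^{-wₙ}` — this is (11);
* `lhs_term_eq_rhs_term` — the resulting equality of the `n`-th terms of the two sides of (9).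
The resummation (Lemma 2 itself, for any absolutely convergent Dirichlet series) is in
`ConreyGhoshTransform.lean`.

## References

* A. R. Booker, *Poles of Artin L-functions and the strong Artin conjecture*, Ann. of Math. (2)
  158 (2003), 1089–1098: Lemma 2, (9)–(11), pp. 1093–1094. [Booker2003]
* J. B. Conrey, A. Ghosh, *Simple zeros of the Ramanujan τ-Dirichlet series*, Invent. Math. 94
  (1988), 403–419 (the original transform). [folklore]
-/

noncomputable section

open _root_.Complex Set MeasureTheory Filter Real
open scoped _root_.Topology

namespace Literature.NumberTheory.LFunctions

namespace ConreyGhosh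

open Literature.Analysis.Complex Literature.Analysis.SpecialFunctions

/-! ### Exponential forms of the complex powers `(r e^{iθ})^w`, `r^w`, `n^w` -/

/-- `log (r e^{iθ}) = log r + iθ` for `r > 0`, `-π < θ ≤ π` (principal branch). [folklore] -/
theorem log_ofReal_mul_exp {r θ : ℝ} (hr : 0 < r) (h₁ : -π < θ) (h₂ : θ ≤ π) :
    Complex.log ((r : ℂ) * cexp (θ * I)) = Real.log r + θ * I := by
  have h : (r : ℂ) * cexp (θ * I) = cexp (Real.log r + θ * I) := by
    rw [Complex.exp_add, ← Complex.ofReal_exp, Real.exp_log hr]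
  rw [h, Complex.log_exp (by simpa using h₁) (by simpa using h₂)]

/-- `(r e^{iθ})^w = exp (w (log r + iθ))` for `r > 0`, `-π < θ ≤ π`. [folklore] -/
theorem ofReal_mul_exp_cpow {r θ : ℝ} (hr : 0 < r) (h₁ : -π < θ) (h₂ : θ ≤ π) (w : ℂ) :
    ((r : ℂ) * cexp (θ * I)) ^ w = cexp (w * (Real.log r + θ * I)) := by
  have hne : (r : ℂ) * cexp (θ * I) ≠ 0 :=
    mul_ne_zero (ofReal_ne_zero.2 hr.ne') (Complex.exp_ne_zero _)
  rw [Complex.cpow_def_of_ne_zero hne, log_ofReal_mul_exp hr h₁ h₂, mul_comm]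

/-- `r^w = exp (w log r)` for real `r > 0`. [folklore] -/
theorem ofReal_cpow_eq_exp {r : ℝ} (hr : 0 < r) (w : ℂ) : (r : ℂ) ^ w = cexp (w * Real.log r) := by
  rw [Complex.cpow_def_of_ne_zero (ofReal_ne_zero.2 hr.ne'), ← Complex.ofReal_log hr.le, mul_comm]

/-- `n^w = exp (w log n)` for `n ≥ 1`. [folklore] -/
theorem natCast_cpow_eq_exp {n : ℕ} (hn : 0 < n) (w : ℂ) :
    (n : ℂ) ^ w = cexp (w * Real.log n) := by
  have h := ofReal_cpow_eq_exp (r := (n : ℝ)) (by exact_mod_cast hn) w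
  simpa using h

/-- The real part of `r e^{iθ}` is `r cos θ`. [folklore] -/
theorem re_ofReal_mul_exp (r θ : ℝ) : ((r : ℂ) * cexp (θ * I)).re = r * Real.cos θ := by
  rw [Complex.exp_mul_I, ← Complex.ofReal_cos, ← Complex.ofReal_sin]
  simp [Complex.cos_ofReal_re]

/-! ### Booker's Lemma 2: the two kernels, pointwise -/

/-- Pointwise form of the left kernel of Booker's (9):
`n^{-s} (α e^{iθ})^{1/2-s} (2π)^{-s} = (α e^{iθ})^{1/2} · (2παn e^{iθ})^{-s}` (`|θ| < π`; all powers
principal). [cite: Booker2003, Lemma 2 (p. 1093, proof, (11))] -/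
theorem lhs_factor {α θ : ℝ} (hα : 0 < α) (hθ₁ : -π < θ) (hθ₂ : θ ≤ π) {n : ℕ} (hn : 0 < n)
    (s : ℂ) :
    (n : ℂ) ^ (-s) * ((α : ℂ) * cexp (θ * I)) ^ (1 / 2 - s) * (((2 * π : ℝ) : ℂ)) ^ (-s) =
      ((α : ℂ) * cexp (θ * I)) ^ (1 / 2 : ℂ) *
        (((2 * π * α * n : ℝ) : ℂ) * cexp (θ * I)) ^ (-s) := by
  have h2π : (0 : ℝ) < 2 * π := by positivity
  have hn' : (0 : ℝ) < n := by exact_mod_cast hn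
  have hr : (0 : ℝ) < 2 * π * α * n := by positivity
  rw [natCast_cpow_eq_exp hn, ofReal_mul_exp_cpow hα hθ₁ hθ₂, ofReal_mul_exp_cpow hα hθ₁ hθ₂,
    ofReal_cpow_eq_exp h2π, ofReal_mul_exp_cpow hr hθ₁ hθ₂]
  simp only [← Complex.exp_add]
  congr 1
  have hlog : Real.log (2 * π * α * n) = Real.log (2 * π) + Real.log α + Real.log n := by
    rw [Real.log_mul (by positivity) hn'.ne', Real.log_mul h2π.ne' hα.ne']
  rw [hlog]
  push_cast
  ring

/-- Pointwise form of the right kernel of Booker's (9):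
`n^{-s} α^{1/2-s} e^{iν[(δ/2)(s-c-1) + (π/2)(c+1/2)]} (2 sin(δ/2))^{-(s+c)} (2π)^{-s}
 = [α^{1/2} e^{iν[(δ/2)(-c-1) + (π/2)(c+1/2)]} (2 sin(δ/2))^{-c}] · (2παn · 2 sin(δ/2) · e^{-iνδ/2})^{-s}`
(`0 < δ < π`, `ν = ±1`; all powers principal). [cite: Booker2003, Lemma 2 (p. 1093, proof, (11))] -/
theorem rhs_factor {α δ ν : ℝ} (hα : 0 < α) (hδ : 0 < δ) (hδ' : δ < π) (hν : ν = 1 ∨ ν = -1)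
    (c : ℝ) {n : ℕ} (hn : 0 < n) (s : ℂ) :
    (n : ℂ) ^ (-s) * (α : ℂ) ^ (1 / 2 - s) *
        cexp (I * ν * (δ / 2 * (s - c - 1) + π / 2 * (c + 1 / 2))) *
        (((2 * Real.sin (δ / 2) : ℝ) : ℂ)) ^ (-(s + c)) * (((2 * π : ℝ) : ℂ)) ^ (-s) =
      ((α : ℂ) ^ (1 / 2 : ℂ) * cexp (I * ν * (δ / 2 * (-c - 1) + π / 2 * (c + 1 / 2))) *
          (((2 * Real.sin (δ / 2) : ℝ) : ℂ)) ^ (-(c : ℂ))) *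
        (((2 * π * α * n * (2 * Real.sin (δ / 2)) : ℝ) : ℂ) * cexp ((-(ν * δ / 2) : ℝ) * I)) ^
          (-s) := by
  have h2π : (0 : ℝ) < 2 * π := by positivity
  have hn' : (0 : ℝ) < n := by exact_mod_cast hn
  have hsin : 0 < 2 * Real.sin (δ / 2) := by
    have := Real.sin_pos_of_pos_of_lt_pi (by positivity : 0 < δ / 2) (by linarith)
    positivity
  have hr : (0 : ℝ) < 2 * π * α * n * (2 * Real.sin (δ / 2)) := by positivity
  have hν1 : |ν| = 1 := by rcases hν with rfl | rfl <;> simp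
  have hθ₁ : -π < -(ν * δ / 2) := by
    have : |ν * δ / 2| < π := by
      rw [abs_div, abs_mul, hν1, abs_of_pos hδ, abs_two]; linarith
    linarith [(abs_lt.1 this).2]
  have hθ₂ : -(ν * δ / 2) ≤ π := by
    have : |ν * δ / 2| < π := by
      rw [abs_div, abs_mul, hν1, abs_of_pos hδ, abs_two]; linarith
    linarith [(abs_lt.1 this).1]
  rw [natCast_cpow_eq_exp hn, ofReal_cpow_eq_exp hα, ofReal_cpow_eq_exp hα,
    ofReal_cpow_eq_exp hsin, ofReal_cpow_eq_exp hsin, ofReal_cpow_eq_exp h2π,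
    ofReal_mul_exp_cpow hr hθ₁ hθ₂]
  simp only [← Complex.exp_add]
  congr 1
  have hlog : Real.log (2 * π * α * n * (2 * Real.sin (δ / 2))) =
      Real.log (2 * π) + Real.log α + Real.log n + Real.log (2 * Real.sin (δ / 2)) := by
    rw [Real.log_mul (by positivity) hsin.ne', Real.log_mul (by positivity) hn'.ne',
      Real.log_mul h2π.ne' hα.ne']
  rw [hlog]
  push_cast
  ring

/-! ### Booker's Lemma 2: the two kernel integrals, via (10) -/

/-- **Left kernel of (9).** For `σ + c > 0`, `α > 0`, `|θ| < π/2`, `n ≥ 1`, with `s = σ + iy` and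
`z = 2παn e^{iθ}`:
`∫ n^{-s} (α e^{iθ})^{1/2-s} (2π)^{-s} Γ(s + c) dy = (α e^{iθ})^{1/2} · 2π z^c e^{-z}`
(Booker's (10)–(11), first line). [cite: Booker2003, Lemma 2 (p. 1093)] -/
theorem integral_lhs_kernel {σ c α θ : ℝ} (hσc : 0 < σ + c) (hα : 0 < α) (hθ : |θ| < π / 2)
    {n : ℕ} (hn : 0 < n) :
    ∫ y : ℝ, (n : ℂ) ^ (-((σ : ℂ) + y * I)) *
        ((α : ℂ) * cexp (θ * I)) ^ (1 / 2 - ((σ : ℂ) + y * I)) *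
        (((2 * π : ℝ) : ℂ)) ^ (-((σ : ℂ) + y * I)) * Complex.Gamma (σ + c + y * I) =
      ((α : ℂ) * cexp (θ * I)) ^ (1 / 2 : ℂ) *
        (2 * π * ((((2 * π * α * n : ℝ) : ℂ) * cexp (θ * I)) ^ (c : ℂ) *
          cexp (-(((2 * π * α * n : ℝ) : ℂ) * cexp (θ * I))))) := by
  have hπ := Real.pi_pos
  have hn' : (0 : ℝ) < n := by exact_mod_cast hn
  have hθ₁ : -π < θ := by linarith [(abs_lt.1 hθ).1]
  have hθ₂ : θ ≤ π := by linarith [(abs_lt.1 hθ).2]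
  set z : ℂ := ((2 * π * α * n : ℝ) : ℂ) * cexp (θ * I) with hz
  have hzre : 0 < z.re := by
    rw [hz, re_ofReal_mul_exp]
    exact mul_pos (by positivity)
      (Real.cos_pos_of_mem_Ioo ⟨by linarith [(abs_lt.1 hθ).1], (abs_lt.1 hθ).2⟩)
  have hpt : ∀ y : ℝ, (n : ℂ) ^ (-((σ : ℂ) + y * I)) *
        ((α : ℂ) * cexp (θ * I)) ^ (1 / 2 - ((σ : ℂ) + y * I)) *
        (((2 * π : ℝ) : ℂ)) ^ (-((σ : ℂ) + y * I)) * Complex.Gamma (σ + c + y * I) =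
      ((α : ℂ) * cexp (θ * I)) ^ (1 / 2 : ℂ) *
        (Complex.Gamma (σ + c + y * I) * z ^ (-((σ : ℂ) + y * I))) := by
    intro y
    rw [lhs_factor hα hθ₁ hθ₂ hn]
    ring
  rw [integral_congr_ae (Eventually.of_forall hpt), integral_const_mul,
    integral_Gamma_add_mul_cpow_neg_eq hσc hzre]

/-- **Right kernel of (9).** For `σ + c > 0`, `α > 0`, `0 < δ < π/2`, `ν = ±1`, `n ≥ 1`, with
`s = σ + iy` and `w = 2παn · 2 sin(δ/2) · e^{-iνδ/2}`:
`∫ n^{-s} α^{1/2-s} e^{iν[(δ/2)(s-c-1)+(π/2)(c+1/2)]} (2 sin(δ/2))^{-(s+c)} (2π)^{-s} Γ(s+c) dy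
 = α^{1/2} e^{iν[(δ/2)(-c-1)+(π/2)(c+1/2)]} (2 sin(δ/2))^{-c} · 2π w^c e^{-w}`
(Booker's (10)–(11), last line). [cite: Booker2003, Lemma 2 (p. 1094)] -/
theorem integral_rhs_kernel {σ c α δ ν : ℝ} (hσc : 0 < σ + c) (hα : 0 < α) (hδ : 0 < δ)
    (hδ' : δ < π / 2) (hν : ν = 1 ∨ ν = -1) {n : ℕ} (hn : 0 < n) :
    ∫ y : ℝ, (n : ℂ) ^ (-((σ : ℂ) + y * I)) * (α : ℂ) ^ (1 / 2 - ((σ : ℂ) + y * I)) *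
        cexp (I * ν * (δ / 2 * (((σ : ℂ) + y * I) - c - 1) + π / 2 * (c + 1 / 2))) *
        (((2 * Real.sin (δ / 2) : ℝ) : ℂ)) ^ (-(((σ : ℂ) + y * I) + c)) *
        (((2 * π : ℝ) : ℂ)) ^ (-((σ : ℂ) + y * I)) * Complex.Gamma (σ + c + y * I) =
      ((α : ℂ) ^ (1 / 2 : ℂ) * cexp (I * ν * (δ / 2 * (-c - 1) + π / 2 * (c + 1 / 2))) *
          (((2 * Real.sin (δ / 2) : ℝ) : ℂ)) ^ (-(c : ℂ))) *
        (2 * π * ((((2 * π * α * n * (2 * Real.sin (δ / 2)) : ℝ) : ℂ) *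
            cexp ((-(ν * δ / 2) : ℝ) * I)) ^ (c : ℂ) *
          cexp (-(((2 * π * α * n * (2 * Real.sin (δ / 2)) : ℝ) : ℂ) *
            cexp ((-(ν * δ / 2) : ℝ) * I))))) := by
  have hπ := Real.pi_pos
  have hn' : (0 : ℝ) < n := by exact_mod_cast hn
  have hsin : 0 < 2 * Real.sin (δ / 2) := by
    have := Real.sin_pos_of_pos_of_lt_pi (by positivity : 0 < δ / 2) (by linarith)
    positivity
  have hν1 : |ν| = 1 := by rcases hν with rfl | rfl <;> simp
  have hνδ : |ν * δ / 2| < π / 2 := by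
    rw [abs_div, abs_mul, hν1, abs_of_pos hδ, abs_two]; linarith
  set w : ℂ := ((2 * π * α * n * (2 * Real.sin (δ / 2)) : ℝ) : ℂ) *
    cexp ((-(ν * δ / 2) : ℝ) * I) with hw
  have hwre : 0 < w.re := by
    rw [hw, re_ofReal_mul_exp]
    refine mul_pos (by positivity) (Real.cos_pos_of_mem_Ioo ⟨?_, ?_⟩)
    · linarith [(abs_lt.1 hνδ).2]
    · linarith [(abs_lt.1 hνδ).1]
  have hpt : ∀ y : ℝ, (n : ℂ) ^ (-((σ : ℂ) + y * I)) * (α : ℂ) ^ (1 / 2 - ((σ : ℂ) + y * I)) *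
        cexp (I * ν * (δ / 2 * (((σ : ℂ) + y * I) - c - 1) + π / 2 * (c + 1 / 2))) *
        (((2 * Real.sin (δ / 2) : ℝ) : ℂ)) ^ (-(((σ : ℂ) + y * I) + c)) *
        (((2 * π : ℝ) : ℂ)) ^ (-((σ : ℂ) + y * I)) * Complex.Gamma (σ + c + y * I) =
      ((α : ℂ) ^ (1 / 2 : ℂ) * cexp (I * ν * (δ / 2 * (-c - 1) + π / 2 * (c + 1 / 2))) *
          (((2 * Real.sin (δ / 2) : ℝ) : ℂ)) ^ (-(c : ℂ))) *
        (Complex.Gamma (σ + c + y * I) * w ^ (-((σ : ℂ) + y * I))) := by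
    intro y
    rw [rhs_factor hα hδ (by linarith) hν c hn]
    ring
  rw [integral_congr_ae (Eventually.of_forall hpt), integral_const_mul,
    integral_Gamma_add_mul_cpow_neg_eq hσc hwre]

/-! ### The trigonometric identity behind (11) and the termwise equality of the two sides -/

/-- `e^{iν(π/2 - δ)} = iν + 2 sin(δ/2) e^{-iνδ/2}` for `ν = ±1`
(`e^{iνπ/2} = iν` and `iν (e^{-iνδ} - 1) = 2 sin(δ/2) e^{-iνδ/2}`). [folklore] -/
theorem exp_nu_mul_eq {ν : ℝ} (hν : ν = 1 ∨ ν = -1) (δ : ℝ) :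
    cexp (((ν * (π / 2 - δ) : ℝ) : ℂ) * I) =
      I * ν + 2 * Real.sin (δ / 2) * cexp (((-(ν * δ / 2) : ℝ) : ℂ) * I) := by
  have hI : cexp ((π / 2 : ℂ) * I) = I := by
    rw [Complex.exp_mul_I, Complex.cos_pi_div_two, Complex.sin_pi_div_two]; simp
  have hI' : cexp (-(π / 2 : ℂ) * I) = -I := by
    have h1 : -(π / 2 : ℂ) * I = -((π / 2 : ℂ) * I) := by ring
    rw [h1, Complex.exp_neg, hI, Complex.inv_I]
  have h2 : (2 * Real.sin (δ / 2) : ℂ) =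
      (cexp (-((δ / 2 : ℝ) : ℂ) * I) - cexp (((δ / 2 : ℝ) : ℂ) * I)) * I := by
    rw [Complex.ofReal_sin, Complex.two_sin]
  set A : ℂ := cexp (-((δ / 2 : ℝ) : ℂ) * I) with hA
  set B : ℂ := cexp (((δ / 2 : ℝ) : ℂ) * I) with hB
  rcases hν with rfl | rfl
  · have e1 : cexp (((1 * (π / 2 - δ) : ℝ) : ℂ) * I) = cexp ((π / 2 : ℂ) * I) * cexp (-(δ : ℂ) * I) := by
      rw [← Complex.exp_add]; congr 1; push_cast; ring
    have e2 : A * cexp (((-(1 * δ / 2) : ℝ) : ℂ) * I) = cexp (-(δ : ℂ) * I) := by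
      rw [hA, ← Complex.exp_add]; congr 1; push_cast; ring
    have e3 : B * cexp (((-(1 * δ / 2) : ℝ) : ℂ) * I) = 1 := by
      rw [hB, ← Complex.exp_add, ← Complex.exp_zero]; congr 1; push_cast; ring
    rw [h2, e1, hI]
    have h4 : (A - B) * I * cexp (((-(1 * δ / 2) : ℝ) : ℂ) * I) =
        I * (A * cexp (((-(1 * δ / 2) : ℝ) : ℂ) * I)) - I * (B * cexp (((-(1 * δ / 2) : ℝ) : ℂ) * I)) := by
      ring
    rw [h4, e2, e3]
    push_cast
    ring
  · have e1 : cexp (((-1 * (π / 2 - δ) : ℝ) : ℂ) * I) = cexp (-(π / 2 : ℂ) * I) * cexp ((δ : ℂ) * I) := by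
      rw [← Complex.exp_add]; congr 1; push_cast; ring
    have e2 : A * cexp (((-(-1 * δ / 2) : ℝ) : ℂ) * I) = 1 := by
      rw [hA, ← Complex.exp_add, ← Complex.exp_zero]; congr 1; push_cast; ring
    have e3 : B * cexp (((-(-1 * δ / 2) : ℝ) : ℂ) * I) = cexp ((δ : ℂ) * I) := by
      rw [hB, ← Complex.exp_add]; congr 1; push_cast; ring
    rw [h2, e1, hI']
    have h4 : (A - B) * I * cexp (((-(-1 * δ / 2) : ℝ) : ℂ) * I) =
        I * (A * cexp (((-(-1 * δ / 2) : ℝ) : ℂ) * I)) - I * (B * cexp (((-(-1 * δ / 2) : ℝ) : ℂ) * I)) := by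
      ring
    rw [h4, e2, e3]
    push_cast
    ring

/-- **Termwise equality of the two sides of (9)** (Booker's (11)): with `θ = ν(π/2 - δ)`,
`z = 2παn e^{iθ}`, `w = 2παn · 2 sin(δ/2) e^{-iνδ/2}` one has `z = 2πiναn + w`, hence
`e^{-z} = e(-ναn) e^{-w}`, and
`(α e^{iθ})^{1/2} z^c e^{-z} = e(-ναn) · α^{1/2} e^{iν[(δ/2)(-c-1)+(π/2)(c+1/2)]} (2 sin(δ/2))^{-c} · w^c e^{-w}`.
[cite: Booker2003, Lemma 2 (pp. 1093–1094, (11))] -/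
theorem lhs_term_eq_rhs_term {α δ ν : ℝ} (hα : 0 < α) (hδ : 0 < δ) (hδ' : δ < π / 2)
    (hν : ν = 1 ∨ ν = -1) (c : ℝ) {n : ℕ} (hn : 0 < n) :
    ((α : ℂ) * cexp (((ν * (π / 2 - δ) : ℝ) : ℂ) * I)) ^ (1 / 2 : ℂ) *
        (2 * π * ((((2 * π * α * n : ℝ) : ℂ) * cexp (((ν * (π / 2 - δ) : ℝ) : ℂ) * I)) ^ (c : ℂ) *
          cexp (-(((2 * π * α * n : ℝ) : ℂ) * cexp (((ν * (π / 2 - δ) : ℝ) : ℂ) * I))))) =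
      cexp (-(2 * π * I * ν * α * n)) *
        (((α : ℂ) ^ (1 / 2 : ℂ) * cexp (I * ν * (δ / 2 * (-c - 1) + π / 2 * (c + 1 / 2))) *
            (((2 * Real.sin (δ / 2) : ℝ) : ℂ)) ^ (-(c : ℂ))) *
          (2 * π * ((((2 * π * α * n * (2 * Real.sin (δ / 2)) : ℝ) : ℂ) *
              cexp ((-(ν * δ / 2) : ℝ) * I)) ^ (c : ℂ) *
            cexp (-(((2 * π * α * n * (2 * Real.sin (δ / 2)) : ℝ) : ℂ) *
              cexp ((-(ν * δ / 2) : ℝ) * I)))))) := by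
  have hπ := Real.pi_pos
  have hn' : (0 : ℝ) < n := by exact_mod_cast hn
  have hr : (0 : ℝ) < 2 * π * α * n := by positivity
  have hsin : 0 < 2 * Real.sin (δ / 2) := by
    have := Real.sin_pos_of_pos_of_lt_pi (by positivity : 0 < δ / 2) (by linarith)
    positivity
  have hr' : (0 : ℝ) < 2 * π * α * n * (2 * Real.sin (δ / 2)) := by positivity
  have hν1 : |ν| = 1 := by rcases hν with rfl | rfl <;> simp
  have hθ : |ν * (π / 2 - δ)| < π / 2 := by
    rw [abs_mul, hν1, one_mul, abs_lt]; constructor <;> linarith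
  have hθ₁ : -π < ν * (π / 2 - δ) := by linarith [(abs_lt.1 hθ).1]
  have hθ₂ : ν * (π / 2 - δ) ≤ π := by linarith [(abs_lt.1 hθ).2]
  have hνδ : |ν * δ / 2| < π / 2 := by
    rw [abs_div, abs_mul, hν1, abs_of_pos hδ, abs_two]; linarith
  have hφ₁ : -π < -(ν * δ / 2) := by linarith [(abs_lt.1 hνδ).2]
  have hφ₂ : -(ν * δ / 2) ≤ π := by linarith [(abs_lt.1 hνδ).1]
  -- `z = 2πiναn + w`
  have hzw : ((2 * π * α * n : ℝ) : ℂ) * cexp (((ν * (π / 2 - δ) : ℝ) : ℂ) * I) =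
      2 * π * I * ν * α * n + ((2 * π * α * n * (2 * Real.sin (δ / 2)) : ℝ) : ℂ) *
        cexp ((-(ν * δ / 2) : ℝ) * I) := by
    rw [exp_nu_mul_eq hν δ]
    push_cast
    ring
  -- everything in exponential form
  rw [ofReal_mul_exp_cpow hα hθ₁ hθ₂, ofReal_mul_exp_cpow hr hθ₁ hθ₂, ofReal_cpow_eq_exp hα,
    ofReal_cpow_eq_exp hsin, ofReal_mul_exp_cpow hr' hφ₁ hφ₂, hzw]
  have hlog : Real.log (2 * π * α * n * (2 * Real.sin (δ / 2))) =
      Real.log (2 * π * α * n) + Real.log (2 * Real.sin (δ / 2)) :=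
    Real.log_mul hr.ne' hsin.ne'
  rw [hlog]
  -- collect the exponentials
  have key : ∀ A B C D E : ℂ, cexp A * (2 * π * (cexp B * cexp C)) =
      cexp D * (cexp E) * (2 * π) → True := fun _ _ _ _ _ _ ↦ trivial
  simp only [← Complex.exp_add, neg_add_rev]
  rw [show ∀ A B : ℂ, cexp A * (2 * π * cexp B) = 2 * π * cexp (A + B) from fun A B ↦ by
      rw [Complex.exp_add]; ring,
    show ∀ A B C : ℂ, cexp A * (cexp B * (2 * π * cexp C)) = 2 * π * cexp (A + B + C) from
      fun A B C ↦ by rw [Complex.exp_add, Complex.exp_add]; ring]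
  congr 2
  push_cast
  ring

end ConreyGhosh

end Literature.NumberTheory.LFunctions
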